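import Literature.NumberTheory.EllipticCurves.IwasawaNoFiniteSubmoduleProofs
import Mathlib.LinearAlgebra.Dimension.Localization
import Mathlib.LinearAlgebra.Dimension.Torsion.Finite
import Mathlib.LinearAlgebra.Isomorphisms
import HarnessLib

/-!
# Kitajima–Otsuki 2018 §4.2 in rank `r`: Prop. 4.6 (a `Λ`-linear `Λ^r → X` with torsion cokernel
# into a module of `Λ`-rank `≥ r` is injective) + Prop. 4.7 (Greenberg's lemma) ⟹ the shape of
# Thm. 4.8 — «no finite `Λ`-submodule» passes to the target of a surjection whose kernel is the image
# of a free module of rank `r` (pure algebra over `Λ = ℤ_p⟦T⟧`; cell `bsd-potss`, seat `bsd-potss-k8q-c5`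
# g2; K8-Gss2 node (R2±) `NoFiniteSubmoduleSigned`, items stmt-BirchSwinnertonDyer-19117 / 19222 / 19233)

HONEST FRAMING (cell `bsd-potss`, run/shared/lean/pub/bsd-potss/; FULL-BSD rank ≤ 1 programme,
tranche 1b): THEOREMS ONLY — pure commutative algebra over the Iwasawa algebra `Λ = ℤ_p⟦T⟧`
(`IwasawaAlgebra p`), Mathlib + the tree's `IwasawaNoFiniteSubmoduleProofs` (x1b GEN 44: Greenberg's
lemma `forall_finite_eq_bot_quotient_range_pi`, and the rank-ONE Prop. 4.6
`injective_of_isTorsion_quotient_of_not_isTorsion`). NO elliptic-curve input, NO named fact, NO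
definition, nothing asserted about any Selmer group; nothing booked; no label / mark / count moves.
BSD is not proved by any of this. PURPOSE: the K8 binder `PublishedInputKO13` (Kitajima–Otsuki 2018 Main
Thm. 1.3 for `F = ℚ`) is the case `[F_{0,v} : ℚ_p] = p − 1` of Thm. 4.8, whose proof (§4.2, arXiv p. 19)
is: Prop. 4.6 (rank count: `rank_Λ Sel(F_∞)^∨ ≥ Σ_v [F_{0,v}:ℚ_p]` [Gre99, Thm. 1.7] and `Sel^{±∨}`
torsion force the map `ι^± : ⊕_v (H¹(F_{∞,v})/E^± ⊗ ℚ_p/ℤ_p)^∨ ≅ Λ^r → Sel(F_∞)^∨` to be injective) +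
Prop. 4.7 (Greenberg's lemma) applied to `0 → Λ^r → Sel^∨ → Sel^{±∨} → 0`. The tree held the rank-one
shape only; THIS FILE is the rank-`r` shape, in the form the Selmer-side composition consumes (a
SURJECTION `π : X ↠ Y` with `ker π = range ι`, `ι : (Fin r → Λ) → X`).

## Contents

* §1 `injective_of_isTorsion_quotient_of_le_rank` — **Prop. 4.6 in rank `r`**: `ι : (Fin r → Λ) →ₗ X`
  with `X ⧸ range ι` torsion and `r ≤ rank_Λ X` is injective (rank–nullity over the domain `Λ`:
  `rank X = rank (range ι) = r − rank (ker ι)`, and a non-zero kernel inside the torsion-free `Λ^r` has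
  positive rank); `le_rank_of_injective` — the rank hypothesis from an injective `Λ^r ↪ X`.
* §2 `forall_finite_eq_bot_of_surjective_of_ker_eq_range` — Greenberg's lemma transported along
  `X ⧸ range ι ≃ Y` for a surjection `π` with `ker π = range ι`, `ι` injective.
* §3 `forall_finite_eq_bot_of_surjective_of_ker_eq_range_of_le_rank` — **the shape of Thm. 4.8 in rank
  `r`**: `X` without non-zero finite `Λ`-submodule, `π : X ↠ Y` with `Y` torsion, `ker π = range ι`,
  `r ≤ rank_Λ X` ⟹ `Y` has no non-zero finite `Λ`-submodule.

(All modules in `Type`, the universe of `Λ` and of the tree's Selmer duals over number fields in `Type`,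
as in `IwasawaNoFiniteSubmoduleProofs` §4–§5.)

References: [KitajimaOtsuki2018] T. Kitajima, R. Otsuki, Tokyo J. Math. 41 (2018), Prop. 4.6, Prop. 4.7,
Thm. 4.8 (arXiv:1607.03612 p. 19); [GreenbergLNM1716] R. Greenberg, LNM 1716 (1999), pp. 104–105 and
Thm. 1.7; [Washington1997] §13.2.
-/

set_option autoImplicit false

noncomputable section

open scoped Classical

open Literature.NumberTheory.EllipticCurves Literature.NumberTheory.EllipticCurves.IwasawaAlgebra

namespace Summit.BirchSwinnertonDyer.Rank1Residual.Iwasawa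

variable (p : ℕ) [hp : Fact p.Prime]

/-! ## §1 Kitajima–Otsuki Prop. 4.6 in rank `r` -/

section PropFourSix

variable {X : Type} [AddCommGroup X] [Module (IwasawaAlgebra p) X]

/-- The rank hypothesis of Prop. 4.6 from an injective `Λ`-linear `Λ^r ↪ X`: `r ≤ rank_Λ X`
(`rank_Λ Λ^r = r`). In the source the injection is [Gre99] Thm. 1.7's corank bound read on the dual.
[cite: KitajimaOtsuki2018, Prop. 4.6 (proof: rank_Λ Sel(F_∞)^∨ ≥ Σ [F_{0,v}:ℚ_p], arXiv:1607.03612 p. 19)]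
[cite: GreenbergLNM1716, Thm. 1.7] -/
theorem le_rank_of_injective {r : ℕ} (j : (Fin r → IwasawaAlgebra p) →ₗ[IwasawaAlgebra p] X)
    (hj : Function.Injective j) : (r : Cardinal) ≤ Module.rank (IwasawaAlgebra p) X := by
  have h := LinearMap.rank_le_of_injective j hj
  rwa [rank_fin_fun] at h

/-- **Kitajima–Otsuki Prop. 4.6 in rank `r`.** A `Λ`-linear map `ι : Λ^r → X` with `Λ`-torsion
cokernel into a module of `Λ`-rank `≥ r` is injective: over the domain `Λ`,
`rank X = rank (X ⧸ ι(Λ^r)) + rank ι(Λ^r) = rank ι(Λ^r)` (torsion quotient has rank `0`) and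
`rank ι(Λ^r) + rank (ker ι) = r`; a non-zero kernel is a non-zero submodule of the torsion-free `Λ^r`,
of rank `≥ 1`, which would force `r + 1 ≤ r`. In the source: `X = Sel(F_∞, E[p^∞])^∨`,
`Λ^r = ⊕_v (H¹(F_{∞,v}, E[p^∞])/E^± ⊗ ℚ_p/ℤ_p)^∨` (`r = Σ_v [F_{0,v}:ℚ_p]`), the cokernel
`Sel^±(F_∞, E[p^∞])^∨` torsion by (vi) — "the kernel `Ker ι^±` is `Λ`-torsion. Therefore we get the
conclusion since the leftmost direct sum … is a torsion-free `Λ`-module."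
[cite: KitajimaOtsuki2018, Prop. 4.6 (arXiv:1607.03612 p. 19)] -/
theorem injective_of_isTorsion_quotient_of_le_rank {r : ℕ}
    (ι : (Fin r → IwasawaAlgebra p) →ₗ[IwasawaAlgebra p] X)
    (hq : Module.IsTorsion (IwasawaAlgebra p) (X ⧸ LinearMap.range ι))
    (hr : (r : Cardinal) ≤ Module.rank (IwasawaAlgebra p) X) : Function.Injective ι := by
  rw [← LinearMap.ker_eq_bot]
  by_contra hker
  -- `rank X = rank (range ι)` : the quotient is torsion
  have hq0 : Module.rank (IwasawaAlgebra p) (X ⧸ LinearMap.range ι) = 0 :=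
    rank_eq_zero_iff_isTorsion.mpr hq
  have hX : Module.rank (IwasawaAlgebra p) X =
      Module.rank (IwasawaAlgebra p) (LinearMap.range ι) := by
    rw [← rank_quotient_add_rank_of_isDomain (LinearMap.range ι), hq0, zero_add]
  -- rank–nullity for `ι`
  have hrn : Module.rank (IwasawaAlgebra p) (LinearMap.range ι) +
      Module.rank (IwasawaAlgebra p) (LinearMap.ker ι) = r := by
    rw [LinearMap.rank_range_add_rank_ker ι, rank_fin_fun]
  -- the kernel is a non-zero torsion-free module: positive rank
  have hk : 1 ≤ Module.rank (IwasawaAlgebra p) (LinearMap.ker ι) := by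
    rw [Cardinal.one_le_iff_pos, rank_pos_iff_exists_ne_zero]
    obtain ⟨a, ha, ha0⟩ := (Submodule.ne_bot_iff _).mp hker
    exact ⟨⟨a, ha⟩, fun h ↦ ha0 (congrArg Subtype.val h)⟩
  -- `r + 1 ≤ rank (range ι) + rank (ker ι) = r`
  have hle : (r : Cardinal) + 1 ≤ (r : Cardinal) := by
    calc (r : Cardinal) + 1
        ≤ Module.rank (IwasawaAlgebra p) (LinearMap.range ι) +
            Module.rank (IwasawaAlgebra p) (LinearMap.ker ι) := add_le_add (hX ▸ hr) hk
      _ = r := hrn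
  have : ((r + 1 : ℕ) : Cardinal.{0}) ≤ (r : Cardinal.{0}) := by exact_mod_cast hle
  exact absurd (Nat.cast_le.mp this) (by omega)

end PropFourSix

/-! ## §2 Greenberg's lemma along a surjection with free-image kernel -/

section Transport

variable {X Y : Type} [AddCommGroup X] [Module (IwasawaAlgebra p) X]
  [AddCommGroup Y] [Module (IwasawaAlgebra p) Y]

/-- A finite `Λ`-submodule of `Y` pulls back, along a `Λ`-linear equivalence `e : Z ≃ Y`, to a finite
`Λ`-submodule of `Z`; so «no non-zero finite `Λ`-submodule» is invariant under `≃ₗ`. [folklore] -/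
theorem forall_finite_eq_bot_of_linearEquiv {Z : Type} [AddCommGroup Z] [Module (IwasawaAlgebra p) Z]
    (e : Z ≃ₗ[IwasawaAlgebra p] Y)
    (hZ : ∀ N : Submodule (IwasawaAlgebra p) Z, Finite N → N = ⊥) :
    ∀ Q : Submodule (IwasawaAlgebra p) Y, Finite Q → Q = ⊥ := by
  intro Q hQ
  have hfin : Finite (Q.comap (e : Z →ₗ[IwasawaAlgebra p] Y)) := by
    refine Finite.of_injective (fun z : Q.comap (e : Z →ₗ[IwasawaAlgebra p] Y) ↦
      (⟨e (z : Z), z.2⟩ : Q)) fun a b hab ↦ ?_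
    exact Subtype.ext (e.injective (congrArg Subtype.val hab))
  have hbot := hZ _ hfin
  have hmap : Q = (Q.comap (e : Z →ₗ[IwasawaAlgebra p] Y)).map (e : Z →ₗ[IwasawaAlgebra p] Y) :=
    (Submodule.map_comap_eq_of_surjective e.surjective Q).symm
  rw [hmap, hbot, Submodule.map_bot]

/-- **Greenberg's lemma along a surjection** (Kitajima–Otsuki Prop. 4.7 in the shape `0 → Λ^r → X ↠ Y
→ 0`): if `X` has no non-zero finite `Λ`-submodule, `ι : Λ^r → X` is injective and `π : X ↠ Y` is a
`Λ`-linear surjection with `ker π = ι(Λ^r)`, then `Y` has no non-zero finite `Λ`-submodule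
(`Y ≅ X ⧸ ι(Λ^r)` and the tree's `forall_finite_eq_bot_quotient_range_pi`).
[cite: KitajimaOtsuki2018, Prop. 4.7 (arXiv:1607.03612 p. 19)] [cite: GreenbergLNM1716, pp. 104–105] -/
theorem forall_finite_eq_bot_of_surjective_of_ker_eq_range {r : ℕ}
    (hnf : ∀ N : Submodule (IwasawaAlgebra p) X, Finite N → N = ⊥)
    (ι : (Fin r → IwasawaAlgebra p) →ₗ[IwasawaAlgebra p] X) (hι : Function.Injective ι)
    (π : X →ₗ[IwasawaAlgebra p] Y) (hπ : Function.Surjective π)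
    (hker : LinearMap.ker π = LinearMap.range ι) :
    ∀ Q : Submodule (IwasawaAlgebra p) Y, Finite Q → Q = ⊥ := by
  -- `X ⧸ range ι ≃ X ⧸ ker π ≃ Y`
  let e : (X ⧸ LinearMap.range ι) ≃ₗ[IwasawaAlgebra p] Y :=
    (Submodule.quotEquivOfEq _ _ hker.symm).trans (π.quotKerEquivOfSurjective hπ)
  exact forall_finite_eq_bot_of_linearEquiv p e
    (forall_finite_eq_bot_quotient_range_pi p hnf ι hι)

end Transport

/-! ## §3 The shape of Kitajima–Otsuki Thm. 4.8 in rank `r` -/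

section ThmFourEight

variable {X Y : Type} [AddCommGroup X] [Module (IwasawaAlgebra p) X]
  [AddCommGroup Y] [Module (IwasawaAlgebra p) Y]

/-- Torsion transports backwards along a surjection onto `Y` from the quotient by the kernel:
if `π : X ↠ Y` and `Y` is `Λ`-torsion then `X ⧸ ker π` is `Λ`-torsion. [folklore] -/
theorem isTorsion_quotient_of_surjective (π : X →ₗ[IwasawaAlgebra p] Y) (hπ : Function.Surjective π)
    (hY : Module.IsTorsion (IwasawaAlgebra p) Y) (N : Submodule (IwasawaAlgebra p) X)
    (hN : N = LinearMap.ker π) :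
    Module.IsTorsion (IwasawaAlgebra p) (X ⧸ N) := by
  subst hN
  let e : (X ⧸ LinearMap.ker π) ≃ₗ[IwasawaAlgebra p] Y := π.quotKerEquivOfSurjective hπ
  intro z
  obtain ⟨a, ha⟩ := @hY (e z)
  refine ⟨a, e.injective ?_⟩
  rw [map_zero, Submonoid.smul_def, map_smul, ← ha, Submonoid.smul_def]

/-- **The shape of Kitajima–Otsuki Thm. 4.8 in rank `r` (Prop. 4.6 + Prop. 4.7).** Let `X` be a
`Λ`-module with no non-zero finite `Λ`-submodule and `Λ`-rank `≥ r`, `π : X ↠ Y` a `Λ`-linear surjection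
onto a `Λ`-TORSION module whose kernel is the image of a `Λ`-linear `ι : Λ^r → X`. Then `ι` is injective
(Prop. 4.6) and `Y` has no non-zero finite `Λ`-submodule (Prop. 4.7). In the source (F = ℚ,
`F_0 = ℚ(μ_p)`, one prime `v | p`, `r = [F_{0,v} : ℚ_p] = p − 1`): `X = Sel(F_∞, E[p^∞])^∨` (no finite
submodule by Thm. 4.5; rank `≥ r` by [Gre99] Thm. 1.7), `Y = Sel^±(F_∞, E[p^∞])^∨` (torsion by (vi)),
`π` dual to the inclusion `Sel^± ⊆ Sel`, `ι = ι^±` the dual of `Sel → H¹(F_{∞,v}, E[p^∞])/E^± ⊗ ℚ_p/ℤ_p`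
composed with `(H¹(F_{∞,v})/E^± ⊗ ℚ_p/ℤ_p)^∨ ≅ Λ^r` (Prop. 3.32); its image is the annihilator of `Sel^±`,
i.e. `ker π` (exactness of the sequence (4.2)). NOTHING of these inputs is asserted here.
[cite: KitajimaOtsuki2018, Thm. 4.8 with Prop. 4.6–4.7 (arXiv:1607.03612 p. 19)]
[cite: GreenbergLNM1716, pp. 104–105 and Thm. 1.7] -/
theorem forall_finite_eq_bot_of_surjective_of_ker_eq_range_of_le_rank {r : ℕ}
    (hnf : ∀ N : Submodule (IwasawaAlgebra p) X, Finite N → N = ⊥)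
    (hr : (r : Cardinal) ≤ Module.rank (IwasawaAlgebra p) X)
    (ι : (Fin r → IwasawaAlgebra p) →ₗ[IwasawaAlgebra p] X)
    (π : X →ₗ[IwasawaAlgebra p] Y) (hπ : Function.Surjective π)
    (hker : LinearMap.ker π = LinearMap.range ι)
    (hY : Module.IsTorsion (IwasawaAlgebra p) Y) :
    ∀ Q : Submodule (IwasawaAlgebra p) Y, Finite Q → Q = ⊥ :=
  forall_finite_eq_bot_of_surjective_of_ker_eq_range p hnf ι
    (injective_of_isTorsion_quotient_of_le_rank p ι
      (isTorsion_quotient_of_surjective p π hπ hY _ hker.symm) hr)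
    π hπ hker

/-- The same with the rank hypothesis supplied by an injective `Λ`-linear `Λ^r ↪ X` (the form in which
a corank bound `corank_Λ Sel(F_∞) ≥ r` is usually transcribed). [cite: KitajimaOtsuki2018, Thm. 4.8 (arXiv:1607.03612 p. 19)]
[cite: GreenbergLNM1716, Thm. 1.7] -/
theorem forall_finite_eq_bot_of_surjective_of_ker_eq_range_of_injective {r : ℕ}
    (hnf : ∀ N : Submodule (IwasawaAlgebra p) X, Finite N → N = ⊥)
    (j : (Fin r → IwasawaAlgebra p) →ₗ[IwasawaAlgebra p] X) (hj : Function.Injective j)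
    (ι : (Fin r → IwasawaAlgebra p) →ₗ[IwasawaAlgebra p] X)
    (π : X →ₗ[IwasawaAlgebra p] Y) (hπ : Function.Surjective π)
    (hker : LinearMap.ker π = LinearMap.range ι)
    (hY : Module.IsTorsion (IwasawaAlgebra p) Y) :
    ∀ Q : Submodule (IwasawaAlgebra p) Y, Finite Q → Q = ⊥ :=
  forall_finite_eq_bot_of_surjective_of_ker_eq_range_of_le_rank p hnf (le_rank_of_injective p j hj)
    ι π hπ hker hY

end ThmFourEight

end Summit.BirchSwinnertonDyer.Rank1Residual.Iwasawa

end
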